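import Summits.AtomisticToContinuum.Crystallization.Theorems.FreeSplittingCertificatesStrictSplittingRuleP1Far
import Summits.AtomisticToContinuum.Crystallization.Theorems.FreeSplittingCertificatesStrictSplittingRuleFarPencilInflatedF2

/-!
# `StrictSplittingRule` (stmt-AtomisticToContinuum-12560): the far inequality for the P1 interpolant with CERTIFICATE F2 (P1 interpolant object, part 7b)

Route `FreeSplittingCertificates`, crux r3 `StrictSplittingRule` (H12⋆ = `stub_coreJointCoercive`), unit b2b-freesplit-B gen 27.
VALUE = item "`farPencilCert_F2` in the P1 far theorem" of HOME CERT.md §28 (5)(b) / FAR-LEMMA-SPEC §19 (d): the far half of the H12⋆ assembly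
with the certificate the matched split actually uses — `(f_S, f_A, D, C) = (5/2, 5/2, 5/4, 3/4)`, receipts coefficient `t = 2/5`, flux
`(1/3, 4/3, −9/8, 1/8)` (near channels `(1/3, 5/24, 1/8)`; `…FarPencilInflatedF2`, gen 25) — for the interpolant of ANY finitely supported lattice
displacement minus any affine field, at the origin and re-based at any point (`…P1Far`, gen 20).  NOT a proof of H12⋆, NOT summit progress.
-/

noncomputable section

open Set Function Metric MeasureTheory Filter Topology

namespace Summit.AtomisticToContinuum.Crystallization.Theorems.StrictSplittingRuleBirth

/-- **Instance: certificate F2 for the interpolant** (`(5/2, 5/2, 5/4, 3/4)`, `t = 2/5`).  NOT a proof of H12⋆, NOT summit progress. -/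
theorem farPencilF2_weighted_integral_le_p1Disp {a h : ℝ} (ha : 0 < a) (hh : 0 < h) (U : ℤ × ℤ × ℤ → (Fin 3 → ℝ))
    (hU : (support U).Finite) (b₀ : Fin 3 → ℝ) (A : Fin 3 → Fin 3 → ℝ) {R1 R2 : ℝ} (hR1 : 0 < R1) (hR12 : R1 < R2) :
    ∫ x, fpChi (R1 ^ 2) (R2 ^ 2) x ^ 2 * fpNumI (5 / 2) (5 / 2) (5 / 4) (3 / 4) x (p1Disp a h U b₀ A x) (fpGrad (p1Disp a h U b₀ A) x) ≤
      2 / 5 * (∫ x, fpChi (R1 ^ 2) (R2 ^ 2) x ^ 2 * fpDen x (fpGrad (p1Disp a h U b₀ A) x)) +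
        ∫ x, 2 * fpChi (R1 ^ 2) (R2 ^ 2) x *
          fpFlux4DotGrad (1 / 3) (4 / 3) (-(9 / 8)) (1 / 8) (p1Disp a h U b₀ A) (fpChi (R1 ^ 2) (R2 ^ 2)) x :=
  farPencil4_weighted_integral_le_p1Disp farPencilCert_F2 ha hh U hU b₀ A hR1 hR12

/-- **Instance: certificate F2, re-based at any point `y₀`** (use `y₀ = y_p`, `b₀ = u_p − W y_p`, `A = W` for the far ledger of site `p`,
either parity).  NOT a proof of H12⋆, NOT summit progress. -/
theorem farPencilF2_weighted_integral_le_p1Disp_translate {a h : ℝ} (ha : 0 < a) (hh : 0 < h) (U : ℤ × ℤ × ℤ → (Fin 3 → ℝ))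
    (hU : (support U).Finite) (y₀ b₀ : Fin 3 → ℝ) (A : Fin 3 → Fin 3 → ℝ) {R1 R2 : ℝ} (hR1 : 0 < R1) (hR12 : R1 < R2) :
    ∫ x, fpChi (R1 ^ 2) (R2 ^ 2) x ^ 2 *
        fpNumI (5 / 2) (5 / 2) (5 / 4) (3 / 4) x (p1Disp a h U b₀ A (y₀ + x)) (fpGrad (fun y => p1Disp a h U b₀ A (y₀ + y)) x) ≤
      2 / 5 * (∫ x, fpChi (R1 ^ 2) (R2 ^ 2) x ^ 2 * fpDen x (fpGrad (fun y => p1Disp a h U b₀ A (y₀ + y)) x)) +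
        ∫ x, 2 * fpChi (R1 ^ 2) (R2 ^ 2) x *
          fpFlux4DotGrad (1 / 3) (4 / 3) (-(9 / 8)) (1 / 8) (fun y => p1Disp a h U b₀ A (y₀ + y)) (fpChi (R1 ^ 2) (R2 ^ 2)) x :=
  farPencil4_weighted_integral_le_p1Disp_translate farPencilCert_F2 ha hh U hU y₀ b₀ A hR1 hR12

end Summit.AtomisticToContinuum.Crystallization.Theorems.StrictSplittingRuleBirth

end
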